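import Summits.AtomisticToContinuum.HydrodynamicLimit.Theorems.BoxDissipativeWeakStrongEntropyAdmissibilityStubGlobalEquilibriumEntropyBalance

/-!
# Crux `EntropyAdmissibility` (stmt-AtomisticToContinuum-9903), line `registered` — stub `stub_cruxOfFineScaleLLN`

Registered stub FS3 of the line `registered` of the crux
`Summit.AtomisticToContinuum.HydrodynamicLimit.Theses.BoxDissipativeWeakStrong.EntropyAdmissibility`:
**FS1 → (FS2b's conclusion) → `InFrame Cptlgfs` → `InFrame CdynAbs`**. IF at every `t ∈ [0,T)` the box fields
`(ρ̂, m̂, Ê)(t)` converge in `L¹(P_N ⊗ dx)` to the classical Euler state `(ρ, ρu, E(ρ,u,θ))(t,·)` (`InFrame Cptlgfs`, the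
box-scale hydrodynamic limit), THEN the DYNAMIC part `A_N = ∫_{(0,τ]}∫(ρ̂ Z_{a,b}(ŝ) ∂ₜφ + Z_{a,b}(ŝ) m̂·∇φ) dx dt −
∫ ρ̂_τ Z_{a,b}(ŝ_τ) φ_τ dx` of the clamp-renormalised entropy balance converges in `L¹(P_N)` to MINUS the initial entropy
`B`, `E_{P_N}|A_N + B| → 0` (`EABirthGE3.CdynAbs`): the limiting balance is that of the classical solution, which VANISHES
(the second hypothesis = FS2b's conclusion); FS1 (`InFrame Cge1t`) turns the time-`t` LLN into the convergence of the two
entropy functionals `∫ ρ̂_t Z(ŝ_t) ψ dx`, `∫ Z(ŝ_t) m̂_t·Ψ dx`. Proof — the template is the landed global-equilibrium balance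
`EABirthGE3.stub_globalEquilibriumEntropyBalance`: `A_N = ∫_{(0,τ]} g_N(t) dt − k_N` a.s. along the regularised flow
`EABirthS2b.gflow` (`EABirthS1a.dynPart_eq_clamp`; time-clamped test data `ψ₁ = ∂ₜφ`, `ψ₂ = ∇φ`); the three `InFrame`
statements are combined pointwise in the frame (`EABirthCore.InFrame.mono₂`), and FS1 fed with the LLN at `t` gives
`E|g_N(t) − ḡ(t)| → 0` for `t ∈ (0, τ]`, `ḡ(t) = ∫ ρ_t Z_t ∂ₜφ_t dx + ∫ Z_t ⟪ρ_t u_t, ∇φ_t⟫ dx`, `Z_t = Z_{a,b}(s_cut(ρ_t, θ_t))`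
(`tendsto_bulk_at`), and `E|k_N − ∫ ρ_τ Z_τ φ_τ dx| → 0` (`tendsto_bdry_at`) — replacing GE1 + flow-invariance of GE3;
dominated convergence in `t` (`EABirthGE3.tendsto_lintegral_integral_sub`, `EABirthGE3.abs_integral_statBulk_le`,
`EABirthS2bA.exists_lintegral_meanKinetic_le`; `ḡ` is measurable and bounded once time is clamped to `[0, τ]`); the identity
`∫_{(0,τ]} ḡ dt − ∫ ρ_τ Z_τ φ_τ dx + B = 0` is the second hypothesis once the cut entropy is identified with the entropy on
the band, `s_cut(r, ϑ) = 3/2 log ϑ − log r − f_ex(rσ³)` for `rσ³ ≤ η₁` (`cutEntropy_eq_of_le`; packing guard `ρσ³ ≤ η₁/2`,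
`η₁ < η₀`); whence `|A_N + B| ≤ |∫ g_N dt − ∫ ḡ dt| + |k_N − k̄|` a.s. Thresholds: `η₀` of `HsEosLowDensity` (`f_ex`
analytic, hence `C^∞` on `(0, η₀)` and continuous on `[0, η₀)`), `σ < 1/2`.

References: H. Spohn, *Large Scale Dynamics of Interacting Particles* (1991), Part I §2.3, Ch. 3; J. Březina,
E. Feireisl, J. Math. Soc. Japan 70 (2018), Def. 2.9, §3.2. prover-line-stmt-AtomisticToContinuum-9903-c2-0 (worker FS3).
-/

noncomputable section

open MeasureTheory Filter Set
open scoped ENNReal Topology ContDiff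

namespace Summit.AtomisticToContinuum.HydrodynamicLimit.Theorems.EABirthFS3

open Literature.MathematicalPhysics.KineticTheory
open Literature.Analysis.FluidPDE.CompressibleEuler (clamp abs_clamp_le continuous_clamp)
open Summit.AtomisticToContinuum.HydrodynamicLimit.Theses
open Summit.AtomisticToContinuum.HydrodynamicLimit.Theorems.BDWS
open Summit.AtomisticToContinuum.HydrodynamicLimit.Theorems.EABirthCore (Conclusion InFrame)
open Summit.AtomisticToContinuum.HydrodynamicLimit.Theorems.EABirthGE3 (CdynAbs tendsto_lintegral_integral_sub
  integral_statBulk_split abs_integral_statBulk_le)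
open Literature.Analysis.FluidPDE (Config HardSphereFlow)
open Literature.Analysis.FunctionSpaces
open EABirthS1a (statEntropy statBulk statBdry)
open EABirthS2bA (exists_lintegral_meanKinetic_le)
open EABirthS2b (gflow gflow_ae_eq measurable_gflow sum_norm_sq_gflow max_abs_pos)

/-! ## The hypotheses and the conclusion (verbatim the lead's skeleton) -/

/-- **Conclusion `Cptlgfs` — the POSITIVE-TIME fine-scale law of large numbers** (verbatim the skeleton's `Cptlgfs`):
at every `t ∈ [0,T)` the box fields `(ρ̂, m̂, Ê)(t)` converge in `L¹(P_N ⊗ dx)` to the Euler state at `t`. -/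
def Cptlgfs : Conclusion := fun σ _η₁ a₀ θ₀ u₀ T ρ θ u Φ ℓ _τ _a _b _φ =>
  ∀ t ∈ Ico 0 T, Tendsto (fun N : ℕ => ∫⁻ z, ENNReal.ofReal (∫ x,
      (|boxDensity σ ℓ Φ N t z x - ρ t x| + ‖boxMomentum σ ℓ Φ N t z x - ρ t x • u t x‖ +
        |boxEnergy σ ℓ Φ N t z x - totalEnergyDensity (ρ t x) (u t x) (θ t x)|))
    ∂(localGibbsLaw σ a₀ u₀ θ₀ N (Φ N))) atTop (𝓝 0)

/-- **Conclusion `Cge1t` — GE1 at time `t` under the time-`t` fine-scale LLN** (verbatim the skeleton's `Cge1t`). -/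
def Cge1t : Conclusion := fun σ η₁ a₀ θ₀ u₀ T ρ θ u Φ ℓ _τ a b _φ =>
  ∀ t ∈ Ico 0 T,
    Tendsto (fun N : ℕ => ∫⁻ z, ENNReal.ofReal (∫ x,
        (|boxDensity σ ℓ Φ N t z x - ρ t x| + ‖boxMomentum σ ℓ Φ N t z x - ρ t x • u t x‖ +
          |boxEnergy σ ℓ Φ N t z x - totalEnergyDensity (ρ t x) (u t x) (θ t x)|))
      ∂(localGibbsLaw σ a₀ u₀ θ₀ N (Φ N))) atTop (𝓝 0) →
    (∀ ψ : T3 → ℝ, Continuous ψ →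
      Tendsto (fun N : ℕ => ∫⁻ z, ENNReal.ofReal
          |(∫ x, boxDensity σ ℓ Φ N t z x * boxClampedEntropy σ η₁ ℓ Φ a b N t z x * ψ x) -
            ∫ x, ρ t x * clamp a b (cutEntropy σ η₁ (ρ t x) (θ t x)) * ψ x|
        ∂(localGibbsLaw σ a₀ u₀ θ₀ N (Φ N))) atTop (𝓝 0)) ∧
    (∀ Ψ : T3 → V3, Continuous Ψ →
      Tendsto (fun N : ℕ => ∫⁻ z, ENNReal.ofReal
          |(∫ x, boxClampedEntropy σ η₁ ℓ Φ a b N t z x * inner ℝ (boxMomentum σ ℓ Φ N t z x) (Ψ x)) -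
            ∫ x, clamp a b (cutEntropy σ η₁ (ρ t x) (θ t x)) * inner ℝ (ρ t x • u t x) (Ψ x)|
        ∂(localGibbsLaw σ a₀ u₀ θ₀ N (Φ N))) atTop (𝓝 0))

/-- FS1's signature (verbatim). -/
def Sig.stub_fsEntropyFunctionalsLLN : Prop :=
  InFrame Cge1t

/-- FS3's signature (verbatim the skeleton's; the middle hypothesis is FS2b's conclusion, inlined). -/
def Sig.stub_cruxOfFineScaleLLN : Prop :=
  Sig.stub_fsEntropyFunctionalsLLN →
  (∀ (σ η₀ : ℝ), 0 < σ → 0 < η₀ → ContDiffOn ℝ ∞ hsExcessFreeEnergy (Ioo 0 η₀) →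
    ∀ (T : ℝ) (ρ θ : ℝ → T3 → ℝ) (u : ℝ → T3 → V3), IsHardSphereEulerSolution σ T ρ u θ →
      (∀ t ∈ Ico 0 T, ∀ x, ρ t x * σ ^ 3 < η₀) →
      ∀ a b : ℝ, a < b →
      ∀ τ ∈ Ico 0 T, ∀ φ : ℝ → T3 → ℝ, Literature.Analysis.FunctionSpaces.Torus.IsSmoothSpaceTimeOn (Ico 0 T) φ →
        (∫ t in Ioc 0 τ, ∫ x,
            (ρ t x * clamp a b (3 / 2 * Real.log (θ t x) - Real.log (ρ t x) - hsExcessFreeEnergy (ρ t x * σ ^ 3)) *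
                Literature.Analysis.FunctionSpaces.Torus.timeDerivWithin (Ico 0 T) φ t x +
              clamp a b (3 / 2 * Real.log (θ t x) - Real.log (ρ t x) - hsExcessFreeEnergy (ρ t x * σ ^ 3)) *
                inner ℝ (ρ t x • u t x) (Literature.Analysis.FunctionSpaces.Torus.gradient (φ t) x))) -
          (∫ x, ρ τ x * clamp a b (3 / 2 * Real.log (θ τ x) - Real.log (ρ τ x) - hsExcessFreeEnergy (ρ τ x * σ ^ 3)) *
              φ τ x) +
          ∫ x, ρ 0 x * clamp a b (3 / 2 * Real.log (θ 0 x) - Real.log (ρ 0 x) - hsExcessFreeEnergy (ρ 0 x * σ ^ 3)) *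
              φ 0 x = 0) →
  InFrame Cptlgfs → InFrame CdynAbs

/-! ## The cut entropy on the band -/

section CutEntropy
variable {η₀ σ η₁ : ℝ}

/-- **On the band the cut entropy IS the entropy**: `s_cut(r, ϑ) = 3/2 log ϑ − log r − f_ex(rσ³)` whenever
`rσ³ ≤ η₁` (`min (rσ³) η₁ = rσ³`, `max (rσ³) η₁ = η₁`, `log (η₁/η₁) = 0`). -/
theorem cutEntropy_eq_of_le (hη₁ : 0 < η₁) {r : ℝ} (hr : r * σ ^ 3 ≤ η₁) (ϑ : ℝ) :
    cutEntropy σ η₁ r ϑ = 3 / 2 * Real.log ϑ - Real.log r - hsExcessFreeEnergy (r * σ ^ 3) := by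
  unfold cutEntropy cutExcessFreeEnergy
  rw [min_eq_left hr, max_eq_right hr, div_self hη₁.ne', Real.log_one, mul_zero, add_zero]

/-- The cut entropy `(r, ϑ) ↦ s_cut(r, ϑ)` is continuous on the open positive quadrant, provided `f_ex` is continuous
on `[0, η₀)` and `0 < η₁ < η₀` (`f_ex` is only evaluated at `min (rσ³) η₁ ∈ [0, η₁]`). -/
theorem continuousOn_cutEntropy (hcont : ContinuousOn hsExcessFreeEnergy (Ico 0 η₀)) (hσ : 0 ≤ σ) (hη₁ : 0 < η₁)
    (hη₁c : η₁ < η₀) : ContinuousOn (fun p : ℝ × ℝ => cutEntropy σ η₁ p.1 p.2) (Ioi 0 ×ˢ Ioi 0) := by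
  have h1 : ContinuousOn (fun p : ℝ × ℝ => 3 / 2 * Real.log p.2) (Ioi 0 ×ˢ Ioi 0) :=
    continuousOn_const.mul (continuousOn_snd.log fun p hp => ne_of_gt (mem_prod.1 hp).2)
  have h2 : ContinuousOn (fun p : ℝ × ℝ => Real.log p.1) (Ioi 0 ×ˢ Ioi 0) :=
    continuousOn_fst.log fun p hp => ne_of_gt (mem_prod.1 hp).1
  have h3 : ContinuousOn (fun p : ℝ × ℝ => hsExcessFreeEnergy (min (p.1 * σ ^ 3) η₁)) (Ioi 0 ×ˢ Ioi 0) :=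
    hcont.comp ((continuous_fst.mul continuous_const).min continuous_const).continuousOn fun p hp =>
      ⟨le_min (mul_nonneg (le_of_lt (mem_prod.1 hp).1) (pow_nonneg hσ 3)) hη₁.le, (min_le_right _ _).trans_lt hη₁c⟩
  have h4 : ContinuousOn (fun p : ℝ × ℝ => (hsCompressibility η₁ - 1) * Real.log (max (p.1 * σ ^ 3) η₁ / η₁))
      (Ioi 0 ×ˢ Ioi 0) :=
    continuousOn_const.mul ((((continuous_fst.mul continuous_const).max continuous_const).div_const _).continuousOn.log
      fun p _ => (div_pos (hη₁.trans_le (le_max_right _ _)) hη₁).ne')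
  exact (h1.sub h2).sub (h3.add h4)

/-- The clamped cut entropy `x ↦ Z_{a,b}(s_cut(r(x), ϑ(x)))` of continuous positive fields is continuous. -/
theorem continuous_clamp_cutEntropy (hcont : ContinuousOn hsExcessFreeEnergy (Ico 0 η₀)) (hσ : 0 ≤ σ) (hη₁ : 0 < η₁)
    (hη₁c : η₁ < η₀) (a b : ℝ) {X : Type*} [TopologicalSpace X] {r ϑ : X → ℝ} (hr : Continuous r) (hϑ : Continuous ϑ)
    (hr0 : ∀ x, 0 < r x) (hϑ0 : ∀ x, 0 < ϑ x) : Continuous fun x => clamp a b (cutEntropy σ η₁ (r x) (ϑ x)) :=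
  (continuous_clamp a b).comp ((continuousOn_cutEntropy hcont hσ hη₁ hη₁c).comp_continuous (hr.prodMk hϑ)
    fun x => mk_mem_prod (mem_Ioi.2 (hr0 x)) (mem_Ioi.2 (hϑ0 x)))

/-- The clamped cut entropy of measurable positive fields is measurable. -/
theorem measurable_clamp_cutEntropy (hcont : ContinuousOn hsExcessFreeEnergy (Ico 0 η₀)) (hσ : 0 ≤ σ) (hη₁ : 0 < η₁)
    (hη₁c : η₁ < η₀) (a b : ℝ) {X : Type*} [MeasurableSpace X] {r ϑ : X → ℝ} (hr : Measurable r) (hϑ : Measurable ϑ)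
    (hr0 : ∀ x, 0 < r x) (hϑ0 : ∀ x, 0 < ϑ x) : Measurable fun x => clamp a b (cutEntropy σ η₁ (r x) (ϑ x)) :=
  (continuous_clamp a b).measurable.comp (EABirthS1a.measurable_comp_of_continuousOn
    (continuousOn_cutEntropy hcont hσ hη₁ hη₁c) (hr.prodMk hϑ)
    fun x => mk_mem_prod (mem_Ioi.2 (hr0 x)) (mem_Ioi.2 (hϑ0 x)))

end CutEntropy

/-! ## Fixed-time limits of the bulk and of the boundary term along the regularised flow -/

section Frame
variable {σ : ℝ} {a₀ θ₀ : T3 → ℝ} {u₀ : T3 → V3} {Φ : FlowFamily σ} {ℓ : ℕ → ℝ} {η₀ η₁ a b : ℝ}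

/-- **The bulk at fixed time.** If at flow-time `t` the two entropy functionals `∫ ρ̂_t Z(ŝ_t) ψ₁(t,·) dx` and
`∫ Z(ŝ_t) m̂_t·ψ₂(t,·) dx` converge in `L¹(P_N)` to `c₁`, `c₂`, then the bulk space integral `∫ statBulk(t)(Ψ_t z, x) dx`
along the regularised flow `Ψ = gflow` (`= Φ_t` a.s.) converges in `L¹(P_N)` to `c₁ + c₂`. -/
theorem tendsto_bulk_at (hcont : ContinuousOn hsExcessFreeEnergy (Ico 0 η₀)) (hσ : 0 < σ) (hη₁ : 0 < η₁)
    (hη₁c : η₁ < η₀) (hab : a < b) (hℓ : ∀ N, 0 < ℓ N ∧ ℓ N ≤ 1)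
    (hgood : ∀ N, localGibbsLaw σ a₀ u₀ θ₀ N (Φ N) (Φ N).goodᶜ = 0)
    {ψ₁ : ℝ → T3 → ℝ} {ψ₂ : ℝ → T3 → V3} (t : ℝ) (hψ₁ : Continuous (ψ₁ t)) (hψ₂ : Continuous (ψ₂ t)) {c₁ c₂ : ℝ}
    (h₁ : Tendsto (fun N : ℕ => ∫⁻ z, ENNReal.ofReal
        |(∫ x, boxDensity σ ℓ Φ N t z x * boxClampedEntropy σ η₁ ℓ Φ a b N t z x * ψ₁ t x) - c₁|
      ∂(localGibbsLaw σ a₀ u₀ θ₀ N (Φ N))) atTop (𝓝 0))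
    (h₂ : Tendsto (fun N : ℕ => ∫⁻ z, ENNReal.ofReal
        |(∫ x, boxClampedEntropy σ η₁ ℓ Φ a b N t z x * inner ℝ (boxMomentum σ ℓ Φ N t z x) (ψ₂ t x)) - c₂|
      ∂(localGibbsLaw σ a₀ u₀ θ₀ N (Φ N))) atTop (𝓝 0)) :
    Tendsto (fun N : ℕ => ∫⁻ z, ENNReal.ofReal
        |(∫ x, statBulk σ η₁ (ℓ N) a b ψ₁ ψ₂ t (gflow (Φ N) t z) x) - (c₁ + c₂)|
      ∂(localGibbsLaw σ a₀ u₀ θ₀ N (Φ N))) atTop (𝓝 0) := by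
  have hF1m : ∀ N, Measurable fun w : Config (N + 1) (Fin 3) T3 => ∫ x, statBdry σ η₁ (ℓ N) a b (ψ₁ t) w x :=
    fun N => ((EABirthS1a.measurable_statBdry (EABirthS1a.measurable_statEntropy (N := N) hcont hσ.le hη₁.le hη₁c
      (hℓ N).1.le a b) hψ₁.measurable).stronglyMeasurable.integral_prod_right').measurable
  have hsum := h₁.add h₂
  rw [add_zero] at hsum
  have h0 : Tendsto (fun N : ℕ => ∫⁻ z, ENNReal.ofReal
      |(∫ x, statBulk σ η₁ (ℓ N) a b ψ₁ ψ₂ t ((Φ N).flow t z) x) - (c₁ + c₂)|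
      ∂(localGibbsLaw σ a₀ u₀ θ₀ N (Φ N))) atTop (𝓝 0) := by
    refine tendsto_of_tendsto_of_tendsto_of_le_of_le' tendsto_const_nhds hsum
      (Eventually.of_forall fun N => bot_le) (Eventually.of_forall fun N => ?_)
    have hmeas : AEMeasurable (fun z => ENNReal.ofReal
        |(∫ x, boxDensity σ ℓ Φ N t z x * boxClampedEntropy σ η₁ ℓ Φ a b N t z x * ψ₁ t x) - c₁|)
        (localGibbsLaw σ a₀ u₀ θ₀ N (Φ N)) :=
      (continuous_abs.measurable.comp (((hF1m N).comp ((Φ N).measurable_flow t)).sub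
        measurable_const)).ennreal_ofReal.aemeasurable
    calc (∫⁻ z, ENNReal.ofReal |(∫ x, statBulk σ η₁ (ℓ N) a b ψ₁ ψ₂ t ((Φ N).flow t z) x) - (c₁ + c₂)|
          ∂(localGibbsLaw σ a₀ u₀ θ₀ N (Φ N)))
        ≤ ∫⁻ z, (ENNReal.ofReal
            |(∫ x, boxDensity σ ℓ Φ N t z x * boxClampedEntropy σ η₁ ℓ Φ a b N t z x * ψ₁ t x) - c₁| +
          ENNReal.ofReal |(∫ x, boxClampedEntropy σ η₁ ℓ Φ a b N t z x *
            inner ℝ (boxMomentum σ ℓ Φ N t z x) (ψ₂ t x)) - c₂|)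
          ∂(localGibbsLaw σ a₀ u₀ θ₀ N (Φ N)) := lintegral_mono fun z => by
          rw [integral_statBulk_split hcont hσ.le hη₁.le hη₁c hab.le (hℓ N).1 hψ₁ hψ₂,
            ← ENNReal.ofReal_add (abs_nonneg _) (abs_nonneg _), add_sub_add_comm]
          exact ENNReal.ofReal_le_ofReal (abs_add_le _ _)
      _ = _ := lintegral_add_left' hmeas _
  refine h0.congr fun N => lintegral_congr_ae ?_
  filter_upwards [gflow_ae_eq (Φ N) (hgood N)] with z hz
  rw [hz t]

/-- **The boundary term at fixed time**: `∫ statBdry(χ)(Ψ_t z, x) dx = ∫ ρ̂_t Z(ŝ_t) χ dx` a.s. (regularised flow). -/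
theorem tendsto_bdry_at (hgood : ∀ N, localGibbsLaw σ a₀ u₀ θ₀ N (Φ N) (Φ N).goodᶜ = 0) (χ : T3 → ℝ) (t : ℝ)
    {c : ℝ} (h : Tendsto (fun N : ℕ => ∫⁻ z, ENNReal.ofReal
        |(∫ x, boxDensity σ ℓ Φ N t z x * boxClampedEntropy σ η₁ ℓ Φ a b N t z x * χ x) - c|
      ∂(localGibbsLaw σ a₀ u₀ θ₀ N (Φ N))) atTop (𝓝 0)) :
    Tendsto (fun N : ℕ => ∫⁻ z, ENNReal.ofReal |(∫ x, statBdry σ η₁ (ℓ N) a b χ (gflow (Φ N) t z) x) - c|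
      ∂(localGibbsLaw σ a₀ u₀ θ₀ N (Φ N))) atTop (𝓝 0) := by
  refine h.congr fun N => lintegral_congr_ae ?_
  filter_upwards [gflow_ae_eq (Φ N) (hgood N)] with z hz
  rw [hz t]
  rfl

end Frame

/-! ## The stub -/

/-- **Registered stub `stub_cruxOfFineScaleLLN` (FS3)** of the line `registered` of the crux stmt-AtomisticToContinuum-9903:
under the box-scale hydrodynamic limit in `L¹` (`InFrame Cptlgfs`), given FS1 (`InFrame Cge1t`) and the weak
clamp-renormalised entropy conservation of classical hard-sphere-Euler solutions (FS2b's conclusion), the dynamic part of the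
clamp-renormalised entropy balance converges in `L¹(P_N)` to minus the initial entropy: `E_{P_N}|A_N + B| → 0`. -/
theorem stub_cruxOfFineScaleLLN : Sig.stub_cruxOfFineScaleLLN := by
  intro h1 h2 h3
  obtain ⟨η₀, hη₀, F, hFan, hFeq, -⟩ := BoxDissipativeWeakStrong.HsEosLowDensity_holds
  have hcont : ContinuousOn hsExcessFreeEnergy (Ico 0 η₀) :=
    (hFan.continuousOn.mono fun η hη => ⟨(neg_lt_zero.2 hη₀).trans_le hη.1, hη.2⟩).congr hFeq
  -- adapted from `MacroClosureLine.Barycentric.contDiffOn_hsExcessFreeEnergy`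
  have hfI : ContDiffOn ℝ ∞ hsExcessFreeEnergy (Ioo 0 η₀) :=
    (hFan.contDiffOn_of_completeSpace.mono fun x hx => ⟨by linarith [hx.1, hx.2], hx.2⟩).congr
      fun x hx => hFeq (Ioo_subset_Ico_self hx)
  refine InFrame.mono₂ (C₁ := Cge1t) (C₂ := Cptlgfs) hη₀ one_half_pos ?_ h1 h3
  intro σ η₁ a₀ θ₀ u₀ T ρ θ u Φ ℓ τ a b φ hη₁ hη₁₀ ha hθ hu ha0 hθ0 hσ hσ2 hsol hguard _ hℓ _ _ hτ hab hφ _ c₁ c₂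
  -- (the fixed-time limits of the two entropy functionals at `t ∈ [0,T)` are `c₁ t ht (c₂ t ht)`: FS1 fed with the LLN)
  -- the local Gibbs laws: probability, carried by the good sets, uniform kinetic moment
  set P : (N : ℕ) → Measure (Config (N + 1) (Fin 3) T3) := fun N => localGibbsLaw σ a₀ u₀ θ₀ N (Φ N)
  have hP : ∀ N, IsProbabilityMeasure (P N) := fun N => isProbabilityMeasure_localGibbsLaw ha hθ hu ha0 hθ0 hσ2.le N (Φ N)
  have hgood : ∀ N, P N (Φ N).goodᶜ = 0 := fun N => by
    show localGibbsLaw σ a₀ u₀ θ₀ N (Φ N) (Φ N).goodᶜ = 0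
    rw [localGibbsLaw_eq]
    exact localGibbsMeasure_absolutelyContinuous σ _ _ _ N (Φ N) (Φ N).measure_compl_good
  obtain ⟨K, hK, hWK⟩ := exists_lintegral_meanKinetic_le ha hθ hu (fun x => (ha0 x).le) hθ0
  have hWK' : ∀ N, ∫⁻ z, ENNReal.ofReal (((N : ℝ) + 1)⁻¹ * ∑ i, ‖(z i).2‖ ^ 2) ∂P N ≤ ENNReal.ofReal K := fun N => hWK σ N (Φ N)
  -- test data: clamped in time to `[0, τ] ⊆ [0, T)`, continuous slices, sup bounds
  have h0T : (0 : ℝ) ∈ Ico 0 T := ⟨le_rfl, hτ.1.trans_lt hτ.2⟩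
  have hIcc : Icc 0 τ ⊆ Ico 0 T := fun t ht => ⟨ht.1, ht.2.trans_lt hτ.2⟩
  have hS : UniqueDiffOn ℝ (Ico 0 T) := uniqueDiffOn_Ico 0 T
  have hcl : ∀ t : ℝ, max 0 (min t τ) ∈ Icc 0 τ := fun t => ⟨le_max_left _ _, max_le hτ.1 (min_le_right _ _)⟩
  set ψ₁ : ℝ → T3 → ℝ := fun s => Torus.timeDerivWithin (Ico 0 T) φ (max 0 (min s τ)) with hψ₁
  set ψ₂ : ℝ → T3 → V3 := fun s => Torus.gradient (φ (max 0 (min s τ))) with hψ₂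
  have hψ₁c : ∀ t, Continuous (ψ₁ t) := fun t => ((hφ.timeDerivWithin hS).isSmooth_slice (hIcc (hcl t))).continuous
  have hψ₂c : ∀ t, Continuous (ψ₂ t) := fun t => ((hφ.gradient hS).isSmooth_slice (hIcc (hcl t))).continuous
  have hφτ : Continuous (φ τ) := (hφ.isSmooth_slice (hIcc ⟨hτ.1, le_rfl⟩)).continuous
  obtain ⟨D, hD⟩ := (hφ.timeDerivWithin hS).exists_norm_le_of_isCompact isCompact_Icc hIcc
  obtain ⟨Gs, hGs⟩ := (hφ.gradient hS).exists_norm_le_of_isCompact isCompact_Icc hIcc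
  have hD0 : 0 ≤ D := (norm_nonneg _).trans (hD 0 ⟨le_rfl, hτ.1⟩ 0)
  have hGs0 : 0 ≤ Gs := (norm_nonneg _).trans (hGs 0 ⟨le_rfl, hτ.1⟩ 0)
  have hM := max_abs_pos hab
  -- the Euler data: positive on `[0, T)`, bounded on `[0, τ]`
  obtain ⟨R, hR⟩ := hsol.smooth_density.exists_norm_le_of_isCompact isCompact_Icc hIcc
  obtain ⟨U, hU⟩ := hsol.smooth_velocity.exists_norm_le_of_isCompact isCompact_Icc hIcc
  have hR0 : 0 ≤ R := (norm_nonneg _).trans (hR 0 ⟨le_rfl, hτ.1⟩ 0)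
  have hU0 : 0 ≤ U := (norm_nonneg _).trans (hU 0 ⟨le_rfl, hτ.1⟩ 0)
  -- the limits: `Zs t x = Z_{a,b}(s_cut(ρ_t, θ_t))`, `ḡ` (time clamped to `[0, τ]`), `k̄`, `B`
  set Zs : ℝ → T3 → ℝ := fun s x => clamp a b (cutEntropy σ η₁ (ρ s x) (θ s x)) with hZs
  have hZsM : ∀ s x, |Zs s x| ≤ max |a| |b| := fun s x => abs_clamp_le hab.le _
  have hZsc : ∀ s ∈ Ico 0 T, Continuous (Zs s) := fun s hs =>
    continuous_clamp_cutEntropy hcont hσ.le hη₁ hη₁₀ a b (hsol.smooth_density.isSmooth_slice hs).continuous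
      (hsol.smooth_temperature.isSmooth_slice hs).continuous (hsol.density_pos s hs) (hsol.temperature_pos s hs)
  set gbar : ℝ → ℝ := fun t => (∫ x, ρ (max 0 (min t τ)) x * Zs (max 0 (min t τ)) x * ψ₁ t x) +
    ∫ x, Zs (max 0 (min t τ)) x * inner ℝ (ρ (max 0 (min t τ)) x • u (max 0 (min t τ)) x) (ψ₂ t x) with hgbar
  set kbar : ℝ := ∫ x, ρ τ x * Zs τ x * φ τ x with hkbar
  -- the bulk `g N t z` and the boundary `k N z` along the regularised flow
  set g : ∀ N : ℕ, ℝ → Config (N + 1) (Fin 3) T3 → ℝ := fun N t z =>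
    ∫ x, statBulk σ η₁ (ℓ N) a b ψ₁ ψ₂ t (gflow (Φ N) t z) x with hg
  set k : ∀ N : ℕ, Config (N + 1) (Fin 3) T3 → ℝ := fun N z =>
    ∫ x, statBdry σ η₁ (ℓ N) a b (φ τ) (gflow (Φ N) τ z) x with hk
  -- Step A: `L¹` convergence of the bulk at every fixed time `t ∈ (0, τ]`
  have cA : ∀ t ∈ Ioc 0 τ, Tendsto (fun N : ℕ => ∫⁻ z, ENNReal.ofReal |g N t z - gbar t| ∂P N) atTop (𝓝 0) := by
    intro t ht
    have ht' : t ∈ Ico 0 T := ⟨ht.1.le, ht.2.trans_lt hτ.2⟩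
    simp only [hgbar, min_eq_left ht.2, max_eq_right ht.1.le]
    exact tendsto_bulk_at hcont hσ hη₁ hη₁₀ hab hℓ hgood t (hψ₁c t) (hψ₂c t)
      ((c₁ t ht' (c₂ t ht')).1 (ψ₁ t) (hψ₁c t)) ((c₁ t ht' (c₂ t ht')).2 (ψ₂ t) (hψ₂c t))
  -- Step B: the time integral (dominated convergence in `t`)
  have hbd : ∀ N t z, |g N t z| ≤ (max |a| |b| * D + max |a| |b| * Gs / 2) +
      max |a| |b| * Gs / 2 * (((N : ℝ) + 1)⁻¹ * ∑ i, ‖(z i).2‖ ^ 2) := fun N t z => by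
    rw [← sum_norm_sq_gflow (Φ N) t z]
    exact abs_integral_statBulk_le (σ := σ) (η₁ := η₁) (ψ₁ := ψ₁) (ψ₂ := ψ₂) (t := t) hab.le (hℓ N).1 (hℓ N).2
      (fun x => hD _ (hcl t) x) (fun x => hGs _ (hcl t) x) (gflow (Φ N) t z)
  have hm₁ : Measurable fun q : ℝ × T3 => ψ₁ q.1 q.2 :=
    EABirthS1a.measurable_clampTime (hφ.timeDerivWithin hS).continuousOn_stLift hτ.1 hIcc
  have hm₂ : Measurable fun q : ℝ × T3 => ψ₂ q.1 q.2 :=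
    EABirthS1a.measurable_clampTime (u := fun s => Torus.gradient (φ s)) (hφ.gradient hS).continuousOn_stLift hτ.1 hIcc
  have hgm : ∀ N, Measurable fun p : ℝ × Config (N + 1) (Fin 3) T3 => g N p.1 p.2 := fun N => by
    have h3 := EABirthS1a.measurable_statBulk (EABirthS1a.measurable_statEntropy (N := N) hcont hσ.le hη₁.le hη₁₀
      (hℓ N).1.le a b) hm₁ hm₂
    exact ((h3.comp ((measurable_fst.comp measurable_fst).prodMk ((measurable_gflow (Φ N)).comp measurable_fst)
      |>.prodMk measurable_snd)).stronglyMeasurable.integral_prod_right').measurable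
  have hgbar_m : Measurable gbar := by
    have hmρ : Measurable fun q : ℝ × T3 => ρ (max 0 (min q.1 τ)) q.2 :=
      EABirthS1a.measurable_clampTime hsol.smooth_density.continuousOn_stLift hτ.1 hIcc
    have hmθ : Measurable fun q : ℝ × T3 => θ (max 0 (min q.1 τ)) q.2 :=
      EABirthS1a.measurable_clampTime hsol.smooth_temperature.continuousOn_stLift hτ.1 hIcc
    have hmu : Measurable fun q : ℝ × T3 => u (max 0 (min q.1 τ)) q.2 :=
      EABirthS1a.measurable_clampTime hsol.smooth_velocity.continuousOn_stLift hτ.1 hIcc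
    have hmZ : Measurable fun q : ℝ × T3 => Zs (max 0 (min q.1 τ)) q.2 :=
      measurable_clamp_cutEntropy hcont hσ.le hη₁ hη₁₀ a b hmρ hmθ (fun q => hsol.density_pos _ (hIcc (hcl q.1)) q.2)
        fun q => hsol.temperature_pos _ (hIcc (hcl q.1)) q.2
    exact (((hmρ.mul hmZ).mul hm₁).stronglyMeasurable.integral_prod_right' (ν := volume)).measurable.add
      ((hmZ.mul ((hmρ.smul hmu).inner hm₂)).stronglyMeasurable.integral_prod_right' (ν := volume)).measurable
  have hgbar_bd : ∀ t, |gbar t| ≤ R * max |a| |b| * D + max |a| |b| * (R * U) * Gs := fun t => by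
    have b1 : ‖∫ x, ρ (max 0 (min t τ)) x * Zs (max 0 (min t τ)) x * ψ₁ t x‖ ≤ R * max |a| |b| * D := by
      have h := norm_integral_le_of_norm_le_const (μ := (volume : Measure T3)) (C := R * max |a| |b| * D)
        (f := fun x => ρ (max 0 (min t τ)) x * Zs (max 0 (min t τ)) x * ψ₁ t x) (Eventually.of_forall fun x => by
          rw [norm_mul, norm_mul, Real.norm_eq_abs (Zs _ _)]
          exact mul_le_mul (mul_le_mul (hR _ (hcl t) x) (hZsM _ _) (abs_nonneg _) hR0) (hD _ (hcl t) x)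
            (norm_nonneg _) (by positivity))
      simpa only [probReal_univ, mul_one] using h
    have b2 : ‖∫ x, Zs (max 0 (min t τ)) x * inner ℝ (ρ (max 0 (min t τ)) x • u (max 0 (min t τ)) x) (ψ₂ t x)‖ ≤
        max |a| |b| * (R * U) * Gs := by
      have h := norm_integral_le_of_norm_le_const (μ := (volume : Measure T3)) (C := max |a| |b| * (R * U) * Gs)
        (f := fun x => Zs (max 0 (min t τ)) x * inner ℝ (ρ (max 0 (min t τ)) x • u (max 0 (min t τ)) x) (ψ₂ t x))
        (Eventually.of_forall fun x => by
          rw [Real.norm_eq_abs, abs_mul, mul_assoc]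
          refine mul_le_mul (hZsM _ _) ((abs_real_inner_le_norm _ _).trans (mul_le_mul ?_ (hGs _ (hcl t) x)
            (norm_nonneg _) (by positivity))) (abs_nonneg _) hM.le
          rw [norm_smul]
          exact mul_le_mul (hR _ (hcl t) x) (hU _ (hcl t) x) (norm_nonneg _) hR0)
      simpa only [probReal_univ, mul_one] using h
    rw [← Real.norm_eq_abs]
    exact (norm_add_le _ _).trans (add_le_add b1 b2)
  obtain ⟨hint, hbulk⟩ := tendsto_lintegral_integral_sub P hP (volume.restrict (Ioc 0 τ)) (g := g) (m := gbar) hgm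
    (fun N => by fun_prop) (fun N z => by positivity) hWK' (by positivity) (by positivity) hK hbd hgbar_m hgbar_bd
    (ae_restrict_of_forall_mem measurableSet_Ioc cA)
  -- Step C: the boundary term
  have hbdry : Tendsto (fun N : ℕ => ∫⁻ z, ENNReal.ofReal |k N z - kbar| ∂P N) atTop (𝓝 0) :=
    tendsto_bdry_at hgood (φ τ) τ ((c₁ τ hτ (c₂ τ hτ)).1 (φ τ) hφτ)
  -- Step D: the deterministic identity (FS2b's conclusion, the cut entropy being the entropy on the band)
  have hZsS : ∀ t ∈ Ico 0 T, ∀ x, Zs t x =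
      clamp a b (3 / 2 * Real.log (θ t x) - Real.log (ρ t x) - hsExcessFreeEnergy (ρ t x * σ ^ 3)) :=
    fun t ht x => congrArg (clamp a b) (cutEntropy_eq_of_le hη₁ ((hguard t ht x).trans (by linarith)) _)
  have hband : ∀ t ∈ Ico 0 T, ∀ x, ρ t x * σ ^ 3 < η₀ := fun t ht x => (hguard t ht x).trans_lt (by linarith)
  have hL := h2 σ η₀ hσ hη₀ hfI T ρ θ u hsol hband a b hab τ hτ φ hφ
  have hAbar : (∫ t in Ioc 0 τ, gbar t) = ∫ t in Ioc 0 τ, ∫ x,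
      (ρ t x * clamp a b (3 / 2 * Real.log (θ t x) - Real.log (ρ t x) - hsExcessFreeEnergy (ρ t x * σ ^ 3)) *
          Torus.timeDerivWithin (Ico 0 T) φ t x +
        clamp a b (3 / 2 * Real.log (θ t x) - Real.log (ρ t x) - hsExcessFreeEnergy (ρ t x * σ ^ 3)) *
          inner ℝ (ρ t x • u t x) (Torus.gradient (φ t) x)) := by
    refine setIntegral_congr_fun measurableSet_Ioc fun t ht => ?_
    have ht' : t ∈ Ico 0 T := ⟨ht.1.le, ht.2.trans_lt hτ.2⟩
    have hc1 : Continuous (Torus.timeDerivWithin (Ico 0 T) φ t) := ((hφ.timeDerivWithin hS).isSmooth_slice ht').continuous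
    have hc2 : Continuous (Torus.gradient (φ t)) := ((hφ.gradient hS).isSmooth_slice ht').continuous
    have hρc : Continuous (ρ t) := (hsol.smooth_density.isSmooth_slice ht').continuous
    have huc : Continuous (u t) := (hsol.smooth_velocity.isSmooth_slice ht').continuous
    have i1 : Integrable (fun x => ρ t x * Zs t x * Torus.timeDerivWithin (Ico 0 T) φ t x) :=
      integrable_of_continuous_T3 ((hρc.mul (hZsc t ht')).mul hc1)
    have i2 : Integrable (fun x => Zs t x * inner ℝ (ρ t x • u t x) (Torus.gradient (φ t) x)) :=
      integrable_of_continuous_T3 ((hZsc t ht').mul ((hρc.smul huc).inner hc2))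
    simp only [hgbar, hψ₁, hψ₂, min_eq_left ht.2, max_eq_right ht.1.le]
    rw [← integral_add i1 i2]
    exact integral_congr_ae (ae_of_all _ fun x => by dsimp only; rw [hZsS t ht' x])
  have hkbar' : kbar = ∫ x, ρ τ x *
      clamp a b (3 / 2 * Real.log (θ τ x) - Real.log (ρ τ x) - hsExcessFreeEnergy (ρ τ x * σ ^ 3)) * φ τ x :=
    integral_congr_ae (ae_of_all _ fun x => by dsimp only; rw [hZsS τ hτ x])
  have hB' : initLimit σ η₁ ρ θ a b φ = ∫ x, ρ 0 x *
      clamp a b (3 / 2 * Real.log (θ 0 x) - Real.log (ρ 0 x) - hsExcessFreeEnergy (ρ 0 x * σ ^ 3)) * φ 0 x :=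
    integral_congr_ae (ae_of_all _ fun x => by dsimp only; rw [cutEntropy_eq_of_le hη₁ ((hguard 0 h0T x).trans (by linarith))])
  have hD' : (∫ t in Ioc 0 τ, gbar t) - kbar + initLimit σ η₁ ρ θ a b φ = 0 := by rw [hAbar, hkbar', hB']; exact hL
  -- Step E: assembly, `|A_N + B| ≤ |∫ g_N dt − ∫ ḡ dt| + |k_N − k̄|` almost surely
  have hfin : Tendsto (fun N : ℕ => (∫⁻ z, ENNReal.ofReal |(∫ t in Ioc 0 τ, g N t z) - ∫ t in Ioc 0 τ, gbar t| ∂P N) +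
      ∫⁻ z, ENNReal.ofReal |k N z - kbar| ∂P N) atTop (𝓝 0) := by
    simpa only [add_zero] using hbulk.add hbdry
  refine tendsto_of_tendsto_of_tendsto_of_le_of_le' tendsto_const_nhds hfin
    (Eventually.of_forall fun N => bot_le) (Eventually.of_forall fun N => ?_)
  have hmeas : AEMeasurable (fun z => ENNReal.ofReal |(∫ t in Ioc 0 τ, g N t z) - ∫ t in Ioc 0 τ, gbar t|) (P N) :=
    (continuous_abs.measurable.comp_aemeasurable
      ((hint N).aestronglyMeasurable.aemeasurable.sub aemeasurable_const)).ennreal_ofReal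
  calc (∫⁻ z, ENNReal.ofReal |dynPart σ η₁ T ℓ Φ τ a b φ N z + initLimit σ η₁ ρ θ a b φ| ∂P N)
      ≤ ∫⁻ z, (ENNReal.ofReal |(∫ t in Ioc 0 τ, g N t z) - ∫ t in Ioc 0 τ, gbar t| +
          ENNReal.ofReal |k N z - kbar|) ∂P N := lintegral_mono_ae ?_
    _ = _ := lintegral_add_left' hmeas _
  filter_upwards [gflow_ae_eq (Φ N) (hgood N)] with z hz
  rw [← ENNReal.ofReal_add (abs_nonneg _) (abs_nonneg _)]
  refine ENNReal.ofReal_le_ofReal ?_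
  have hAz : dynPart σ η₁ T ℓ Φ τ a b φ N z = (∫ t in Ioc 0 τ, g N t z) - k N z := by
    rw [EABirthS1a.dynPart_eq_clamp]
    simp only [← hz, hk, hg]
    rfl
  rw [hAz]
  calc |(∫ t in Ioc 0 τ, g N t z) - k N z + initLimit σ η₁ ρ θ a b φ|
      = |((∫ t in Ioc 0 τ, g N t z) - ∫ t in Ioc 0 τ, gbar t) - (k N z - kbar)| := by
        congr 1; linarith [hD']
    _ ≤ |(∫ t in Ioc 0 τ, g N t z) - ∫ t in Ioc 0 τ, gbar t| + |k N z - kbar| := abs_sub _ _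

end Summit.AtomisticToContinuum.HydrodynamicLimit.Theorems.EABirthFS3

end
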